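import Summits.CriticalPhenomena.PercolationContinuityZ3.Theorems.Transplant.SkelFrmQuasiBParamsFaceFloorsPinSYA
import Summits.CriticalPhenomena.PercolationContinuityZ3.Theorems.Transplant.SkelFrmBParamsFaceFloorsPinSYA
import Summits.CriticalPhenomena.PercolationContinuityZ3.Theorems.Transplant.SkelFrmQuasiBParamsFaceFloorsLAdYA
import Summits.CriticalPhenomena.PercolationContinuityZ3.Theorems.Transplant.SkelFrmBParamsFaceFloorsLAdYA
import Summits.CriticalPhenomena.PercolationContinuityZ3.Theorems.Transplant.SkelFrmQuasiBParamsFaceOriginsYLA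
import Summits.CriticalPhenomena.PercolationContinuityZ3.Theorems.Transplant.SkelFrmBParamsFaceOriginsYLA
import Summits.CriticalPhenomena.PercolationContinuityZ3.Theorems.Transplant.SkelFrmQuasiBParamsFaceOriginsXA
import Summits.CriticalPhenomena.PercolationContinuityZ3.Theorems.Transplant.SkelFrmBParamsFaceOriginsXA
import Summits.CriticalPhenomena.PercolationContinuityZ3.Theorems.Transplant.SkelFrmQuasiBParamsFaceOriginsYA
import Summits.CriticalPhenomena.PercolationContinuityZ3.Theorems.Transplant.SkelFrmBParamsFaceOriginsYA
import Summits.CriticalPhenomena.PercolationContinuityZ3.Theorems.Transplant.SkelFrmQuasiBParamsFramesF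
import Summits.CriticalPhenomena.PercolationContinuityZ3.Theorems.Transplant.SkelFrmBParamsFramesF
import Summits.CriticalPhenomena.PercolationContinuityZ3.Theorems.Transplant.SkelFrmQuasiBParamsFaceFloorsClrYF
import Summits.CriticalPhenomena.PercolationContinuityZ3.Theorems.Transplant.SkelFrmBParamsFaceFloorsClrYF
import Summits.CriticalPhenomena.PercolationContinuityZ3.Theorems.Transplant.SkelFrmQuasiBParamsFaceFloorsClrYA
import Summits.CriticalPhenomena.PercolationContinuityZ3.Theorems.Transplant.SkelFrmBParamsFaceFloorsClrYA
import Summits.CriticalPhenomena.PercolationContinuityZ3.Theorems.Transplant.SkelFrmQuasiBParamsFaceFloorsFAYA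
import Summits.CriticalPhenomena.PercolationContinuityZ3.Theorems.Transplant.SkelFrmBParamsFaceFloorsFAYA
import Summits.CriticalPhenomena.PercolationContinuityZ3.Theorems.Transplant.SkelFrmQuasiBParamsFaceFloorsFBYA
import Summits.CriticalPhenomena.PercolationContinuityZ3.Theorems.Transplant.SkelFrmBParamsFaceFloorsFBYA
import Summits.CriticalPhenomena.PercolationContinuityZ3.Theorems.Transplant.SkelFrmQuasiBParamsFaceFloorsFTYA
import Summits.CriticalPhenomena.PercolationContinuityZ3.Theorems.Transplant.SkelFrmBParamsFaceFloorsFTYA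
import Summits.CriticalPhenomena.PercolationContinuityZ3.Theorems.Transplant.SkelFrmQuasiBParamsFaceFloorsLYA
import Summits.CriticalPhenomena.PercolationContinuityZ3.Theorems.Transplant.SkelFrmBParamsFaceFloorsLYA
import Summits.CriticalPhenomena.PercolationContinuityZ3.Theorems.Transplant.SkelFrmQuasiBParamsFaceFloorsQYA
import Summits.CriticalPhenomena.PercolationContinuityZ3.Theorems.Transplant.SkelFrmBParamsFaceFloorsQYA
import Summits.CriticalPhenomena.PercolationContinuityZ3.Theorems.Transplant.SkelFrmQuasiBParamsFaceFloorsZPiYA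
import Summits.CriticalPhenomena.PercolationContinuityZ3.Theorems.Transplant.SkelFrmBParamsFaceFloorsZPiYA
import Summits.CriticalPhenomena.PercolationContinuityZ3.Theorems.Transplant.SkelFrmQuasiBParamsFaceFloorsZYA
import Summits.CriticalPhenomena.PercolationContinuityZ3.Theorems.Transplant.SkelFrmBParamsFaceFloorsZYA
import Summits.CriticalPhenomena.PercolationContinuityZ3.Theorems.Transplant.SkelFrmQuasiBParamsFaceFloorsPinYA
import Summits.CriticalPhenomena.PercolationContinuityZ3.Theorems.Transplant.SkelFrmBParamsFaceFloorsPinYA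
import Summits.CriticalPhenomena.PercolationContinuityZ3.Theorems.Transplant.SkelFrmQuasiBParamsFaceCountsYA
import Summits.CriticalPhenomena.PercolationContinuityZ3.Theorems.Transplant.SkelFrmBParamsFaceCountsYA
import Summits.CriticalPhenomena.PercolationContinuityZ3.Theorems.Transplant.SkelFrmQuasiBParamsFaceCountsRangeYA
import Summits.CriticalPhenomena.PercolationContinuityZ3.Theorems.Transplant.SkelFrmBParamsFaceCountsRangeYA
import Summits.CriticalPhenomena.PercolationContinuityZ3.Theorems.Transplant.SkelFrmQuasiBParamsFaceCountsShiftYA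
import Summits.CriticalPhenomena.PercolationContinuityZ3.Theorems.Transplant.SkelFrmBParamsFaceCountsShiftYA
import Summits.CriticalPhenomena.PercolationContinuityZ3.Theorems.Transplant.SkelPhiFaceNumsYP2T
import Summits.CriticalPhenomena.PercolationContinuityZ3.Theorems.Transplant.SkelFrmQuasiBChoiceWindow
import Summits.CriticalPhenomena.PercolationContinuityZ3.Theorems.Transplant.SkelFrmBChoiceWindow
import Summits.CriticalPhenomena.PercolationContinuityZ3.Theorems.Transplant.PlanarSkeletonFrmQuasiDefs
import Summits.CriticalPhenomena.PercolationContinuityZ3.Theorems.Transplant.PlanarSkeletonFrmDefs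
import Summits.CriticalPhenomena.PercolationContinuityZ3.Theorems.Transplant.SkelPhiStepIDataNS
import Summits.CriticalPhenomena.PercolationContinuityZ3.Theorems.Transplant.SkelFrmFromBParamsFaceFloorsY2SA
import Summits.CriticalPhenomena.PercolationContinuityZ3.Theorems.Transplant.SkelFrmBParamsFaceFloorsY2SA
import Summits.CriticalPhenomena.PercolationContinuityZ3.Theorems.Transplant.SkelFrmQuasiBParamsFaceFloorsY2WB
import Summits.CriticalPhenomena.PercolationContinuityZ3.Theorems.Transplant.SkelFrmBParamsFaceFloorsY2WB
import Summits.CriticalPhenomena.PercolationContinuityZ3.Theorems.Transplant.SkelFrmQuasi1SlotTypes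
import HarnessLib
import Summits.CriticalPhenomena.PercolationContinuityZ3.Theorems.Transplant.SkelFrmBParamsFaceFloorsY2WC
/-!
# GEN-Q PORT (WAVE-Q table v0.8 section 2, row G225, U-level L24; captain R-6/R-7 2026-08-27: carrier token swap `PlanarSkeletonFrmFrom ↦ PlanarSkeletonFrmQuasi`)
# of the tree module «Transplant/SkelFrmFromBParamsFaceFloorsY2WC» (sha256 dbd86f740c9f50d8…) onto the quasi-step carrier `PlanarSkeletonFrmQuasi` (p507026): «SkelFrmQuasiBParamsFaceFloorsY2WC»

HAND HUNK (L-FLOORMAP-1 ①⑥ / L-KitS-1 reader side; G017 «SkelFrmQuasiBChoiceNums», hp-8's KitSN): R'0×18 — the (S0) kit of record at window cost `KS.NQ Φ`.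

ORIGINAL TITLE: N2 (frames-only node, OPEN) — (F) value layer under (R-44)(c): **THE ONE-SIDED y′-FACE ASSEMBLY `KS.floorsY2_YFsW`** (hp-8 g43)

builds on p205010 (kernel theorem, internal audit signed; external expert review pending) — nothing in this file uses p205010; NOTHING is claimed about any open node
((N3-b), the end state).  Lane `prim-bschramm`, seat `prim-bschramm-stmt` (gen 33; GEN-Q column pen; tool = captain gen-1 g4's port_genq.py R-14 --cone + p3-g30's T1 patch).  Helper file (`--supports stmt-CriticalPhenomena-4575 --as helper`).
PORT RULES (U-wave r1–r4 re-used, GEN-Q hunk classes of p3-g29 #6136): declaration order, names and proof texts are those of «SkelFrmFromBParamsFaceFloorsY2WC», byte-identical except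
(i) the carrier token `PlanarSkeletonFrmFrom ↦ PlanarSkeletonFrmQuasi` in binders, `namespace`/`end` lines and qualified names (module names `SkelFrmFrom… ↦ SkelFrmQuasi…`
in imports of already-ported rows); (ii) `Φ.step ↦ Φ.qstep` with the called Steps lemma replaced by its `…Q`/`_q` twin and the cost `Φ.M` threaded (none in this file unless
listed below); (iii) `Φ.cyl_connected ↦ Φ.cyl_reach` readers (none unless listed); (iv) graph-ball radii / window floors ×`Φ.M` (none unless listed).  Carrier-free
residents stay imported/exported from the original «SkelFrmBParamsFaceFloorsY2WC» exactly as in the FrmFrom port.  Docstrings and citations are the original's.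

-/

noncomputable section

open scoped Classical

namespace Summit.CriticalPhenomena.PercolationContinuityZ3.Theorems.Transplant

namespace PlanarSkeletonFrmQuasi

namespace NegB

open Literature.Probability.Percolation Literature.Probability.LatticeModels SimpleGraph KNCells KNLevels
open Literature.Probability.Percolation.KozmaNitzan.Cells (oth sgOf sgOf_sign stepVec_apply_fst)
open SkelConc (Consts)
open Skelφ (shearUnit shearUnit_pos yBoxLoS yBoxHiS ySLo ySHi yBnd xBoxB xSLo xSHi xBoxLoA xBoxHiA crossOffY yPrmW xCoreB xCSLo xCSHi)
open Skelφ.StepI (DataN)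
open ChainPlanar (BridgePrm)
open TwoAxis.Para (modulus)
open Neg

namespace KS

set_option maxHeartbeats 4000000 in
/-- **(R-44)(c) ONE-SIDED y′-face assembly: `Skelφ.FloorsY2T` at the (ζ′) tuple, bridge case same, tangential sign `σT := 1`, window count
`N₃ := N3WY … yT … bwY` (count at the tangential origin), window of record `b₀ := BSlot.small3`, any hop side `σh`** — all 29 fields; ONE extra premise, the
forward-start row `hTw`. [cite: KozmaNitzan2024, §4 Lemma 11–12 (pp. 21–25)] -/
theorem floorsY2_YFsW (κ : Consts) {V : Type} [DecidableEq V] [Countable V] {G : SimpleGraph V} [G.LocallyFinite] (Φ : PlanarSkeletonFrmQuasi G) (t : V) (p : unitInterval) (D : Skelφ.StepI.DataNS V) (c : ℕ) (mk : ℕ) (gx : Neg.FSlot) (fx : Neg.FSlot) (P : PCells2T) (hP : P.toPCells2 = fcellsA κ Φ t p D (gT mk gx κ Φ t p D) (fT mk fx κ Φ t p D))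
    (hN : EqNumL κ Φ t p D (gT mk gx κ Φ t p D) (fT mk fx κ Φ t p D)) (hκ : (hL κ Φ t p D (gT mk gx κ Φ t p D) (fT mk fx κ Φ t p D)).natAbs ≤ 10 * nL κ Φ t p D (gT mk gx κ Φ t p D) (fT mk fx κ Φ t p D))
    (hnA : 2000 * Neg.Kq κ * (KS0.R'0N κ Φ (KS.NQ Φ) t p D mk + 2) ≤ nL κ Φ t p D (gT mk gx κ Φ t p D) (fT mk fx κ Φ t p D))
    (hℓA : 22000 * Neg.Kq κ * (KS0.R'0N κ Φ (KS.NQ Φ) t p D mk + 2) ≤ ℓL κ Φ t p D (gT mk gx κ Φ t p D) (fT mk fx κ Φ t p D))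
    (hS : 16 * SF κ Φ t p D c mk ≤ ML κ Φ t p D (gT mk gx κ Φ t p D)) (hS64 : 64 * SF κ Φ t p D c mk ≤ ML κ Φ t p D (gT mk gx κ Φ t p D))
    (hMR0 : 22000 * (KS0.R'0N κ Φ (KS.NQ Φ) t p D mk + 2) ≤ ML κ Φ t p D (gT mk gx κ Φ t p D)) (hRn0 : KS0.R'0N κ Φ (KS.NQ Φ) t p D mk ≤ nL κ Φ t p D (gT mk gx κ Φ t p D) (fT mk fx κ Φ t p D))
    (hs0 : 6 * (KS0.R'0N κ Φ (KS.NQ Φ) t p D mk : ℤ) + 11 ≤ u₀A κ Φ t p D (gT mk gx κ Φ t p D) (fT mk fx κ Φ t p D)) (hs1 : 14 * (KS0.R'0N κ Φ (KS.NQ Φ) t p D mk : ℤ) + 27 ≤ u₁A κ Φ t p D (gT mk gx κ Φ t p D) (fT mk fx κ Φ t p D))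
    (hkF0 : kF₀A κ Φ t p D c mk (gT mk gx κ Φ t p D) (fT mk fx κ Φ t p D) ≤ 8 * u₀A κ Φ t p D (gT mk gx κ Φ t p D) (fT mk fx κ Φ t p D) + 1)
    (hkF1 : kF₁A κ Φ t p D c mk (gT mk gx κ Φ t p D) (fT mk fx κ Φ t p D) ≤ 8 * u₁A κ Φ t p D (gT mk gx κ Φ t p D) (fT mk fx κ Φ t p D) + 1)
    (x : Site 2) (du : MDir) (hd : du.1 = 1) (j : ℕ) (hj : j < P.K) (z : Site 2) {E : ℕ} {kE : ℤ}
    (hlev1 : P.faceL 1 j - E ≤ P.lev du x z)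
    (hlev2 : P.lev du x z ≤ P.faceL 1 j + E)
    (hz : |z 0 - P.cenS x 0| ≤ kE)
    (hEu : (E : ℤ) ≤ u₁A κ Φ t p D (gT mk gx κ Φ t p D) (fT mk fx κ Φ t p D)) (hE2 : (E : ℤ) ≤ 2 * (KS0.R'0N κ Φ (KS.NQ Φ) t p D mk : ℤ))
    (hkE : kE ≤ 5 * (P.r 0 : ℤ))
    (hkE8 : kE + 8 * u₀A κ Φ t p D (gT mk gx κ Φ t p D) (fT mk fx κ Φ t p D) + 8 + P.c 1 ≤ 5 * (P.r 0 : ℤ))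
    (hkE24h : 2 * kE + 24 * u₀A κ Φ t p D (gT mk gx κ Φ t p D) (fT mk fx κ Φ t p D) + 24 + 2 * (P.c 1 : ℤ) ≤ 5 * (P.r 0 : ℤ))
    -- ONE-SIDED ((R-44)(c)): the forward-start row at this contact
    (hTw : 7 * u₀A κ Φ t p D (gT mk gx κ Φ t p D) (fT mk fx κ Φ t p D) ≤ T0Y P x du z + (bwY κ Φ t p D (gT mk gx κ Φ t p D) (fT mk fx κ Φ t p D)))
    (σh : ℤ) (hσh : σh = 1 ∨ σh = -1) (hhopLo : sgOf du * σh = 1 → 0 ≤ vL κ Φ t p D (gT mk gx κ Φ t p D) (fT mk fx κ Φ t p D)) (hhopHi : sgOf du * σh = -1 → vL κ Φ t p D (gT mk gx κ Φ t p D) (fT mk fx κ Φ t p D) ≤ 0)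
    (hc : NrY κ Φ t p D (gT mk gx κ Φ t p D) (fT mk fx κ Φ t p D) P (yLFs κ Φ t p D c mk (gT mk gx κ Φ t p D) (fT mk fx κ Φ t p D) (sgOf du) σh) x du z + 1 ≤ c)
    (r : ℕ) (hr : πBudY κ Φ t p D c mk (gT mk gx κ Φ t p D) (fT mk fx κ Φ t p D) ≤ r) :
    Skelφ.FloorsY2T (prFA κ Φ t p D (gT mk gx κ Φ t p D) (fT mk fx κ Φ t p D)) (nL κ Φ t p D (gT mk gx κ Φ t p D) (fT mk fx κ Φ t p D)) (u₀A κ Φ t p D (gT mk gx κ Φ t p D) (fT mk fx κ Φ t p D)) (u₁A κ Φ t p D (gT mk gx κ Φ t p D) (fT mk fx κ Φ t p D))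
      (modulus (nL κ Φ t p D (gT mk gx κ Φ t p D) (fT mk fx κ Φ t p D)) (hL κ Φ t p D (gT mk gx κ Φ t p D) (fT mk fx κ Φ t p D)) (vL κ Φ t p D (gT mk gx κ Φ t p D) (fT mk fx κ Φ t p D)) (vβL κ Φ t p D (gT mk gx κ Φ t p D) (fT mk fx κ Φ t p D))) (nL κ Φ t p D (gT mk gx κ Φ t p D) (fT mk fx κ Φ t p D) : ℤ) (ℓL κ Φ t p D (gT mk gx κ Φ t p D) (fT mk fx κ Φ t p D))
      P (NegB.BSlot.small3 κ Φ t p D (gT mk gx κ Φ t p D) (fT mk fx κ Φ t p D)) x du j 3 r (Mu D) z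
      (fun i => if i = 0 then kF₀A κ Φ t p D c mk (gT mk gx κ Φ t p D) (fT mk fx κ Φ t p D) else kF₁A κ Φ t p D c mk (gT mk gx κ Φ t p D) (fT mk fx κ Φ t p D))
      σh (BFs κ Φ t p D c mk (gT mk gx κ Φ t p D) (fT mk fx κ Φ t p D) σh) (KS0.R'0N κ Φ (KS.NQ Φ) t p D mk) (qBF κ Φ t p D c mk (gT mk gx κ Φ t p D) (fT mk fx κ Φ t p D)) (KS0.R'0N κ Φ (KS.NQ Φ) t p D mk) (qB3YA κ Φ t p D (gT mk gx κ Φ t p D) (fT mk fx κ Φ t p D) (KS0.R'0N κ Φ (KS.NQ Φ) t p D mk))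
      (yLFs κ Φ t p D c mk (gT mk gx κ Φ t p D) (fT mk fx κ Φ t p D) (sgOf du) σh) (NrY κ Φ t p D (gT mk gx κ Φ t p D) (fT mk fx κ Φ t p D) P (yLFs κ Φ t p D c mk (gT mk gx κ Φ t p D) (fT mk fx κ Φ t p D) (sgOf du) σh) x du z) (N3WY κ Φ t p D (gT mk gx κ Φ t p D) (fT mk fx κ Φ t p D) P ((yLFs κ Φ t p D c mk (gT mk gx κ Φ t p D) (fT mk fx κ Φ t p D) (sgOf du) σh) + Skelφ.crossOffY (nL κ Φ t p D (gT mk gx κ Φ t p D) (fT mk fx κ Φ t p D)) (ℓL κ Φ t p D (gT mk gx κ Φ t p D) (fT mk fx κ Φ t p D)) (hL κ Φ t p D (gT mk gx κ Φ t p D) (fT mk fx κ Φ t p D)) (vL κ Φ t p D (gT mk gx κ Φ t p D) (fT mk fx κ Φ t p D)) (sgOf du) (NrY κ Φ t p D (gT mk gx κ Φ t p D) (fT mk fx κ Φ t p D) P (yLFs κ Φ t p D c mk (gT mk gx κ Φ t p D) (fT mk fx κ Φ t p D) (sgOf du) σh) x du z)) x du z (bwY κ Φ t p D (gT mk gx κ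 Φ t p D) (fT mk fx κ Φ t p D))) 1 := by
  have hσ : sgOf du = 1 ∨ sgOf du = -1 := sgOf_sign du
  have hR0' : (0 : ℤ) ≤ (KS0.R'0N κ Φ (KS.NQ Φ) t p D mk : ℤ) := by positivity
  have hs1' : 6 * (KS0.R'0N κ Φ (KS.NQ Φ) t p D mk : ℤ) + 11 ≤ u₁A κ Φ t p D (gT mk gx κ Φ t p D) (fT mk fx κ Φ t p D) := by linarith
  obtain ⟨-, hsP, -⟩ := cells_of_hP κ Φ t p D (gT mk gx κ Φ t p D) (fT mk fx κ Φ t p D) P hP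
  have es0 : ((P.s 0 : ℕ) : ℤ) = u₀A κ Φ t p D (gT mk gx κ Φ t p D) (fT mk fx κ Φ t p D) := by rw [hsP 0]; rfl
  have es1 : ((P.s 1 : ℕ) : ℤ) = u₁A κ Φ t p D (gT mk gx κ Φ t p D) (fT mk fx κ Φ t p D) := by rw [hsP 1]; rfl
  have hqB2 := two_U_qBF_le κ Φ t p D c mk (gT mk gx κ Φ t p D) (fT mk fx κ Φ t p D) hN hκ
  have hyl := (hyl_yLF κ Φ t p D c mk gx (fT mk fx κ Φ t p D) hN hκ hS hMR0 hσ hσh).1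
  obtain ⟨hΛ₀, hΛ₁⟩ := Λ_yLFs κ Φ t p D c mk gx (fT mk fx κ Φ t p D) hN hκ hS hMR0 hσ hσh
  have hσT : (1 : ℤ) = 1 ∨ (1 : ℤ) = -1 := Or.inl rfl
  have he0 : |FcA κ Φ t p D (gT mk gx κ Φ t p D) (fT mk fx κ Φ t p D) (yLFs κ Φ t p D c mk (gT mk gx κ Φ t p D) (fT mk fx κ Φ t p D) (sgOf du) σh)| ≤ 5 * u₀A κ Φ t p D (gT mk gx κ Φ t p D) (fT mk fx κ Φ t p D) := abs_FcA_le_of_Λ₀ κ Φ t p D (gT mk gx κ Φ t p D) (fT mk fx κ Φ t p D) hN (yLFs κ Φ t p D c mk (gT mk gx κ Φ t p D) (fT mk fx κ Φ t p D) (sgOf du) σh) hΛ₀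
  have he1 : |F1cA κ Φ t p D (gT mk gx κ Φ t p D) (fT mk fx κ Φ t p D) (yLFs κ Φ t p D c mk (gT mk gx κ Φ t p D) (fT mk fx κ Φ t p D) (sgOf du) σh)| ≤ 2 * u₁A κ Φ t p D (gT mk gx κ Φ t p D) (fT mk fx κ Φ t p D) := abs_F1cA_le_of_Λ₁ κ Φ t p D (gT mk gx κ Φ t p D) (fT mk fx κ Φ t p D) hN (yLFs κ Φ t p D c mk (gT mk gx κ Φ t p D) (fT mk fx κ Φ t p D) (sgOf du) σh) hΛ₁
  have hu0 : 1 ≤ u₀A κ Φ t p D (gT mk gx κ Φ t p D) (fT mk fx κ Φ t p D) := (units_eqA κ Φ t p D (gT mk gx κ Φ t p D) (fT mk fx κ Φ t p D)).2.2.2.2.1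
  have hu1 : 1 ≤ u₁A κ Φ t p D (gT mk gx κ Φ t p D) (fT mk fx κ Φ t p D) := (units_eqA κ Φ t p D (gT mk gx κ Φ t p D) (fT mk fx κ Φ t p D)).2.2.2.2.2
  have he0' : |FcA κ Φ t p D (gT mk gx κ Φ t p D) (fT mk fx κ Φ t p D) (yLFs κ Φ t p D c mk (gT mk gx κ Φ t p D) (fT mk fx κ Φ t p D) (sgOf du) σh)| ≤ 6 * u₀A κ Φ t p D (gT mk gx κ Φ t p D) (fT mk fx κ Φ t p D) := by linarith
  have he1' : |F1cA κ Φ t p D (gT mk gx κ Φ t p D) (fT mk fx κ Φ t p D) (yLFs κ Φ t p D c mk (gT mk gx κ Φ t p D) (fT mk fx κ Φ t p D) (sgOf du) σh)| ≤ 6 * u₁A κ Φ t p D (gT mk gx κ Φ t p D) (fT mk fx κ Φ t p D) := by linarith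
  obtain ⟨hX, hNr⟩ := NrY_range κ Φ t p D (gT mk gx κ Φ t p D) (fT mk fx κ Φ t p D) P hP x du hd z hj hlev1 hlev2 (yLFs κ Φ t p D c mk (gT mk gx κ Φ t p D) (fT mk fx κ Φ t p D) (sgOf du) σh) he1 (by linarith)
  have hΛ₁3 : |Λ₁of κ Φ t p D (gT mk gx κ Φ t p D) (fT mk fx κ Φ t p D) (yLFs κ Φ t p D c mk (gT mk gx κ Φ t p D) (fT mk fx κ Φ t p D) (sgOf du) σh)| ≤ 3 * modulus (nL κ Φ t p D (gT mk gx κ Φ t p D) (fT mk fx κ Φ t p D)) (hL κ Φ t p D (gT mk gx κ Φ t p D) (fT mk fx κ Φ t p D)) (vL κ Φ t p D (gT mk gx κ Φ t p D) (fT mk fx κ Φ t p D)) (vβL κ Φ t p D (gT mk gx κ Φ t p D) (fT mk fx κ Φ t p D)) :=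
    hΛ₁.trans (by linarith [abs_nonneg (Λ₁of κ Φ t p D (gT mk gx κ Φ t p D) (fT mk fx κ Φ t p D) (yLFs κ Φ t p D c mk (gT mk gx κ Φ t p D) (fT mk fx κ Φ t p D) (sgOf du) σh))])
  have hqB4 := four_U_qBF_le κ Φ t p D c mk (gT mk gx κ Φ t p D) (fT mk fx κ Φ t p D) hN hκ hS hℓA
  have hNr1000 : NrY κ Φ t p D (gT mk gx κ Φ t p D) (fT mk fx κ Φ t p D) P (yLFs κ Φ t p D c mk (gT mk gx κ Φ t p D) (fT mk fx κ Φ t p D) (sgOf du) σh) x du z + 1 ≤ 1000 * Neg.Kq κ := by have := Neg.one_le_Kq κ; omega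
  have hkE24 : 2 * kE + 24 * u₀A κ Φ t p D (gT mk gx κ Φ t p D) (fT mk fx κ Φ t p D) + 24 + 2 * (P.c 1 : ℤ) ≤ 5 * (P.r 0 : ℤ) := hkE24h
  refine ⟨?_, ?_, hσT, ?_, ?_, ?_, ?_, ?_, ?_, ?_, ?_, ?_, ?_, ?_, ?_, ?_, ?_, ?_, ?_, ?_, ?_, hσh, ?_, ?_, ?_, ?_, ?_, ?_, ?_⟩
  · exact hfR_YA κ Φ t p D c mk (gT mk gx κ Φ t p D) (fT mk fx κ Φ t p D) P hP x du hd j (by exact hj) z (by rw [hd]; exact hlev1) (by rw [hd]; exact hlev2) hz hEu hkF0 hkF1 hs1 hkE8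
  · exact hZfar_YW κ Φ t p D c mk (gT mk gx κ Φ t p D) (fT mk fx κ Φ t p D) P hP x du hd j hj z (by rw [hd]; exact hlev2) hEu hkF1
  · intro hσ1 k hk; rw [hd]; try rw [es1]
    exact (floorsFA_YA κ Φ t p D (gT mk gx κ Φ t p D) (fT mk fx κ Φ t p D) mk P hP hN hκ hℓA hs1' x du hd j hj z hlev1 hlev2 hE2 (yLFs κ Φ t p D c mk (gT mk gx κ Φ t p D) (fT mk fx κ Φ t p D) (sgOf du) σh) he1' hΛ₁3 hqB4).1 hσ1 k hk
  · intro hσ1 k hk; rw [hd]; try rw [es1]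
    exact (floorsFA_YA κ Φ t p D (gT mk gx κ Φ t p D) (fT mk fx κ Φ t p D) mk P hP hN hκ hℓA hs1' x du hd j hj z hlev1 hlev2 hE2 (yLFs κ Φ t p D c mk (gT mk gx κ Φ t p D) (fT mk fx κ Φ t p D) (sgOf du) σh) he1' hΛ₁3 hqB4).2.1 hσ1 k hk
  · intro hσ1 k hk; rw [hd]; try rw [es1]
    exact (floorsFA_YA κ Φ t p D (gT mk gx κ Φ t p D) (fT mk fx κ Φ t p D) mk P hP hN hκ hℓA hs1' x du hd j hj z hlev1 hlev2 hE2 (yLFs κ Φ t p D c mk (gT mk gx κ Φ t p D) (fT mk fx κ Φ t p D) (sgOf du) σh) he1' hΛ₁3 hqB4).2.2.1 hσ1 k hk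
  · intro hσ1 k hk; rw [hd]; try rw [es1]
    exact (floorsFA_YA κ Φ t p D (gT mk gx κ Φ t p D) (fT mk fx κ Φ t p D) mk P hP hN hκ hℓA hs1' x du hd j hj z hlev1 hlev2 hE2 (yLFs κ Φ t p D c mk (gT mk gx κ Φ t p D) (fT mk fx κ Φ t p D) (sgOf du) σh) he1' hΛ₁3 hqB4).2.2.2 hσ1 k hk
  · intro k hk; rw [hd]; exact (floorsFB_YA κ Φ t p D (gT mk gx κ Φ t p D) (fT mk fx κ Φ t p D) mk P hN hκ hnA hℓA x z (yLFs κ Φ t p D c mk (gT mk gx κ Φ t p D) (fT mk fx κ Φ t p D) (sgOf du) σh) he0' hz hkE24 hqB4 hNr1000).1 k hk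
  · intro k hk; rw [hd]; exact (floorsFB_YA κ Φ t p D (gT mk gx κ Φ t p D) (fT mk fx κ Φ t p D) mk P hN hκ hnA hℓA x z (yLFs κ Φ t p D c mk (gT mk gx κ Φ t p D) (fT mk fx κ Φ t p D) (sgOf du) σh) he0' hz hkE24 hqB4 hNr1000).2 k hk
  · intro hσ1 k hk; rw [hd]; try rw [es1]
    exact (floorsFT_YW κ Φ t p D (gT mk gx κ Φ t p D) (fT mk fx κ Φ t p D) mk P hP hN hκ hnA hℓA hs0 hs1' x du hd j hj z hlev1 hlev2 hE2 hz hkE hkE24 (yLFs κ Φ t p D c mk (gT mk gx κ Φ t p D) (fT mk fx κ Φ t p D) (sgOf du) σh) he0 he1' hTw).1 hσ1 k hk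
  · intro hσ1 k hk; rw [hd]; try rw [es1]
    exact (floorsFT_YW κ Φ t p D (gT mk gx κ Φ t p D) (fT mk fx κ Φ t p D) mk P hP hN hκ hnA hℓA hs0 hs1' x du hd j hj z hlev1 hlev2 hE2 hz hkE hkE24 (yLFs κ Φ t p D c mk (gT mk gx κ Φ t p D) (fT mk fx κ Φ t p D) (sgOf du) σh) he0 he1' hTw).2.1 hσ1 k hk
  · intro hσ1 k hk; rw [hd]; try rw [es1]
    exact (floorsFT_YW κ Φ t p D (gT mk gx κ Φ t p D) (fT mk fx κ Φ t p D) mk P hP hN hκ hnA hℓA hs0 hs1' x du hd j hj z hlev1 hlev2 hE2 hz hkE hkE24 (yLFs κ Φ t p D c mk (gT mk gx κ Φ t p D) (fT mk fx κ Φ t p D) (sgOf du) σh) he0 he1' hTw).2.2.1 hσ1 k hk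
  · intro hσ1 k hk; rw [hd]; try rw [es1]
    exact (floorsFT_YW κ Φ t p D (gT mk gx κ Φ t p D) (fT mk fx κ Φ t p D) mk P hP hN hκ hnA hℓA hs0 hs1' x du hd j hj z hlev1 hlev2 hE2 hz hkE hkE24 (yLFs κ Φ t p D c mk (gT mk gx κ Φ t p D) (fT mk fx κ Φ t p D) (sgOf du) σh) he0 he1' hTw).2.2.2.1 hσ1 k hk
  · intro k hk; rw [hd]; try rw [es1]
    exact (floorsFT_YW κ Φ t p D (gT mk gx κ Φ t p D) (fT mk fx κ Φ t p D) mk P hP hN hκ hnA hℓA hs0 hs1' x du hd j hj z hlev1 hlev2 hE2 hz hkE hkE24 (yLFs κ Φ t p D c mk (gT mk gx κ Φ t p D) (fT mk fx κ Φ t p D) (sgOf du) σh) he0 he1' hTw).2.2.2.2.1 k hk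
  · intro k hk; rw [hd]; try rw [es1]
    exact (floorsFT_YW κ Φ t p D (gT mk gx κ Φ t p D) (fT mk fx κ Φ t p D) mk P hP hN hκ hnA hℓA hs0 hs1' x du hd j hj z hlev1 hlev2 hE2 hz hkE hkE24 (yLFs κ Φ t p D c mk (gT mk gx κ Φ t p D) (fT mk fx κ Φ t p D) (sgOf du) σh) he0 he1' hTw).2.2.2.2.2 k hk
  · have h := (floorsFL_YW κ Φ t p D (gT mk gx κ Φ t p D) (fT mk fx κ Φ t p D) mk P hP hN hκ hnA hℓA hs0 hs1' x du hd j hj z hlev1 hlev2 hE2 hz hkE (yLFs κ Φ t p D c mk (gT mk gx κ Φ t p D) (fT mk fx κ Φ t p D) (sgOf du) σh) he0 he1' hTw).1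
    try rw [es0] at h
    exact h
  · have h := (floorsFL_YW κ Φ t p D (gT mk gx κ Φ t p D) (fT mk fx κ Φ t p D) mk P hP hN hκ hnA hℓA hs0 hs1' x du hd j hj z hlev1 hlev2 hE2 hz hkE (yLFs κ Φ t p D c mk (gT mk gx κ Φ t p D) (fT mk fx κ Φ t p D) (sgOf du) σh) he0 he1' hTw).2.1
    try rw [es0] at h
    exact h
  · have h := (floorsFL_YW κ Φ t p D (gT mk gx κ Φ t p D) (fT mk fx κ Φ t p D) mk P hP hN hκ hnA hℓA hs0 hs1' x du hd j hj z hlev1 hlev2 hE2 hz hkE (yLFs κ Φ t p D c mk (gT mk gx κ Φ t p D) (fT mk fx κ Φ t p D) (sgOf du) σh) he0 he1' hTw).2.2.1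
    try rw [es0] at h
    exact h
  · have h := (floorsFL_YW κ Φ t p D (gT mk gx κ Φ t p D) (fT mk fx κ Φ t p D) mk P hP hN hκ hnA hℓA hs0 hs1' x du hd j hj z hlev1 hlev2 hE2 hz hkE (yLFs κ Φ t p D c mk (gT mk gx κ Φ t p D) (fT mk fx κ Φ t p D) (sgOf du) σh) he0 he1' hTw).2.2.2
    try rw [es0] at h
    exact h
  · exact hq₃Y_RA κ Φ t p D (gT mk gx κ Φ t p D) (fT mk fx κ Φ t p D) (KS0.R'0N κ Φ (KS.NQ Φ) t p D mk) hNr1000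
  · exact hW_YA₂ κ Φ t p D c mk (gT mk gx κ Φ t p D) (fT mk fx κ Φ t p D) hN hκ hℓA hS64 hNr hqB2
  · exact hxaF_s κ Φ t p D c mk gx fx hRn0 hN hσ hσh
  · exact hxbF_s κ Φ t p D c mk gx fx hN hσ hσh
  · exact hclrLo_YFs κ Φ t p D c mk (gT mk gx κ Φ t p D) (fT mk fx κ Φ t p D) hN du hhopLo hc
  · exact hclrHi_YFs κ Φ t p D c mk (gT mk gx κ Φ t p D) (fT mk fx κ Φ t p D) hN du hhopHi hc
  · exact hclr₃_YW κ Φ t p D mk (gT mk gx κ Φ t p D) (fT mk fx κ Φ t p D) P hP hN hκ hℓA x du hd j hj z hlev1 hlev2 hz hEu hkE (yLFs κ Φ t p D c mk (gT mk gx κ Φ t p D) (fT mk fx κ Φ t p D) (sgOf du) σh) he0 he1' hs0 hTw _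
  · exact hπ2Y_YA κ Φ t p D c mk (gT mk gx κ Φ t p D) (fT mk fx κ Φ t p D) P hP hN hκ hℓA x du hd j hj z hlev1 hlev2 hEu (yLFs κ Φ t p D c mk (gT mk gx κ Φ t p D) (fT mk fx κ Φ t p D) (sgOf du) σh) he1' hyl _ r hr
  · exact hπ3Y_YW κ Φ t p D c mk (gT mk gx κ Φ t p D) (fT mk fx κ Φ t p D) P hP hN hκ hℓA x du hd j hj z hlev1 hlev2 hz hEu hkE (yLFs κ Φ t p D c mk (gT mk gx κ Φ t p D) (fT mk fx κ Φ t p D) (sgOf du) σh) he0 he1' hs0 hTw hyl r hr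

/-- **The one-sided y′ counts' ranges** (what the packager reads for the capped witnesses): `NrY + 1 ≤ 600·Kq` and `N3WY … yT … + 1 ≤ 240·Kq + 10`. [folklore] -/
theorem rangesY_YFsW (κ : Consts) {V : Type} [DecidableEq V] [Countable V] {G : SimpleGraph V} [G.LocallyFinite] (Φ : PlanarSkeletonFrmQuasi G) (t : V) (p : unitInterval) (D : Skelφ.StepI.DataNS V) (c : ℕ) (mk : ℕ) (gx : Neg.FSlot) (fx : Neg.FSlot) (P : PCells2T) (hP : P.toPCells2 = fcellsA κ Φ t p D (gT mk gx κ Φ t p D) (fT mk fx κ Φ t p D))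
    (hN : EqNumL κ Φ t p D (gT mk gx κ Φ t p D) (fT mk fx κ Φ t p D)) (hκ : (hL κ Φ t p D (gT mk gx κ Φ t p D) (fT mk fx κ Φ t p D)).natAbs ≤ 10 * nL κ Φ t p D (gT mk gx κ Φ t p D) (fT mk fx κ Φ t p D))
    (hS : 16 * SF κ Φ t p D c mk ≤ ML κ Φ t p D (gT mk gx κ Φ t p D)) (hMR0 : 22000 * (KS0.R'0N κ Φ (KS.NQ Φ) t p D mk + 2) ≤ ML κ Φ t p D (gT mk gx κ Φ t p D))
    (x : Site 2) (du : MDir) (hd : du.1 = 1) (j : ℕ) (hj : j < P.K) (z : Site 2) {E : ℕ} {kE : ℤ}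
    (hlev1 : P.faceL 1 j - E ≤ P.lev du x z) (hlev2 : P.lev du x z ≤ P.faceL 1 j + E)
    (hz : |z 0 - P.cenS x 0| ≤ kE) (hEu : (E : ℤ) ≤ u₁A κ Φ t p D (gT mk gx κ Φ t p D) (fT mk fx κ Φ t p D)) (hkE : kE ≤ 5 * (P.r 0 : ℤ))
    (hℓA : 22000 * Neg.Kq κ * (KS0.R'0N κ Φ (KS.NQ Φ) t p D mk + 2) ≤ ℓL κ Φ t p D (gT mk gx κ Φ t p D) (fT mk fx κ Φ t p D)) (hs0 : 6 * (KS0.R'0N κ Φ (KS.NQ Φ) t p D mk : ℤ) + 11 ≤ u₀A κ Φ t p D (gT mk gx κ Φ t p D) (fT mk fx κ Φ t p D))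
    (σh : ℤ) (hσh : σh = 1 ∨ σh = -1) (hTw : 7 * u₀A κ Φ t p D (gT mk gx κ Φ t p D) (fT mk fx κ Φ t p D) ≤ T0Y P x du z + (bwY κ Φ t p D (gT mk gx κ Φ t p D) (fT mk fx κ Φ t p D))) :
    NrY κ Φ t p D (gT mk gx κ Φ t p D) (fT mk fx κ Φ t p D) P (yLFs κ Φ t p D c mk (gT mk gx κ Φ t p D) (fT mk fx κ Φ t p D) (sgOf du) σh) x du z + 1 ≤ 600 * Neg.Kq κ ∧
      N3WY κ Φ t p D (gT mk gx κ Φ t p D) (fT mk fx κ Φ t p D) P ((yLFs κ Φ t p D c mk (gT mk gx κ Φ t p D) (fT mk fx κ Φ t p D) (sgOf du) σh) + Skelφ.crossOffY (nL κ Φ t p D (gT mk gx κ Φ t p D) (fT mk fx κ Φ t p D)) (ℓL κ Φ t p D (gT mk gx κ Φ t p D) (fT mk fx κ Φ t p D)) (hL κ Φ t p D (gT mk gx κ Φ t p D) (fT mk fx κ Φ t p D)) (vL κ Φ t p D (gT mk gx κ Φ t p D) (fT mk fx κ Φ t p D)) (sgOf du) (NrY κ Φ t p D (gT mk gx κ Φ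 t p D) (fT mk fx κ Φ t p D) P (yLFs κ Φ t p D c mk (gT mk gx κ Φ t p D) (fT mk fx κ Φ t p D) (sgOf du) σh) x du z)) x du z (bwY κ Φ t p D (gT mk gx κ Φ t p D) (fT mk fx κ Φ t p D)) + 1 ≤ 240 * Neg.Kq κ + 10 := by
  have hσ : sgOf du = 1 ∨ sgOf du = -1 := sgOf_sign du
  obtain ⟨he0, he1, -⟩ := he_yLFs κ Φ t p D c mk gx (fT mk fx κ Φ t p D) hN hκ hS hMR0 hσ hσh
  have hu1 : 1 ≤ u₁A κ Φ t p D (gT mk gx κ Φ t p D) (fT mk fx κ Φ t p D) := (units_eqA κ Φ t p D (gT mk gx κ Φ t p D) (fT mk fx κ Φ t p D)).2.2.2.2.2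
  have hu0 : 1 ≤ u₀A κ Φ t p D (gT mk gx κ Φ t p D) (fT mk fx κ Φ t p D) := (units_eqA κ Φ t p D (gT mk gx κ Φ t p D) (fT mk fx κ Φ t p D)).2.2.2.2.1
  obtain ⟨-, hNr600⟩ := NrY_range κ Φ t p D (gT mk gx κ Φ t p D) (fT mk fx κ Φ t p D) P hP x du hd z hj hlev1 hlev2 (yLFs κ Φ t p D c mk (gT mk gx κ Φ t p D) (fT mk fx κ Φ t p D) (sgOf du) σh) he1 (by linarith)
  have hR0 : (0 : ℤ) ≤ (KS0.R'0N κ Φ (KS.NQ Φ) t p D mk : ℤ) := by positivity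
  have hNr' : ((NrY κ Φ t p D (gT mk gx κ Φ t p D) (fT mk fx κ Φ t p D) P (yLFs κ Φ t p D c mk (gT mk gx κ Φ t p D) (fT mk fx κ Φ t p D) (sgOf du) σh) x du z : ℕ) : ℤ) + 1 ≤ 600 * (Neg.Kq κ : ℤ) := by exact_mod_cast hNr600
  have hℓ' : 22000 * (Neg.Kq κ : ℤ) * ((KS0.R'0N κ Φ (KS.NQ Φ) t p D mk : ℤ) + 2) ≤ (ℓL κ Φ t p D (gT mk gx κ Φ t p D) (fT mk fx κ Φ t p D) : ℤ) := by exact_mod_cast hℓA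
  have hq1 : (1 : ℤ) ≤ Neg.Kq κ := by exact_mod_cast Neg.one_le_Kq κ
  have hℓN : 25 * ((NrY κ Φ t p D (gT mk gx κ Φ t p D) (fT mk fx κ Φ t p D) P (yLFs κ Φ t p D c mk (gT mk gx κ Φ t p D) (fT mk fx κ Φ t p D) (sgOf du) σh) x du z : ℤ) + 1) + 13 ≤ (ℓL κ Φ t p D (gT mk gx κ Φ t p D) (fT mk fx κ Φ t p D) : ℤ) := by nlinarith
  have hF := FcA_crossOffY_sub_abs_le κ Φ t p D (gT mk gx κ Φ t p D) (fT mk fx κ Φ t p D) hN hκ (yLFs κ Φ t p D c mk (gT mk gx κ Φ t p D) (fT mk fx κ Φ t p D) (sgOf du) σh) hσ (NrY κ Φ t p D (gT mk gx κ Φ t p D) (fT mk fx κ Φ t p D) P (yLFs κ Φ t p D c mk (gT mk gx κ Φ t p D) (fT mk fx κ Φ t p D) (sgOf du) σh) x du z) hℓN (by linarith)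
  obtain ⟨hΛ₀, -⟩ := Λ_yLFs κ Φ t p D c mk gx (fT mk fx κ Φ t p D) hN hκ hS hMR0 hσ hσh
  have he5 : |FcA κ Φ t p D (gT mk gx κ Φ t p D) (fT mk fx κ Φ t p D) (yLFs κ Φ t p D c mk (gT mk gx κ Φ t p D) (fT mk fx κ Φ t p D) (sgOf du) σh)| ≤ 5 * u₀A κ Φ t p D (gT mk gx κ Φ t p D) (fT mk fx κ Φ t p D) := abs_FcA_le_of_Λ₀ κ Φ t p D (gT mk gx κ Φ t p D) (fT mk fx κ Φ t p D) hN (yLFs κ Φ t p D c mk (gT mk gx κ Φ t p D) (fT mk fx κ Φ t p D) (sgOf du) σh) hΛ₀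
  have he6 : |FcA κ Φ t p D (gT mk gx κ Φ t p D) (fT mk fx κ Φ t p D) ((yLFs κ Φ t p D c mk (gT mk gx κ Φ t p D) (fT mk fx κ Φ t p D) (sgOf du) σh) + Skelφ.crossOffY (nL κ Φ t p D (gT mk gx κ Φ t p D) (fT mk fx κ Φ t p D)) (ℓL κ Φ t p D (gT mk gx κ Φ t p D) (fT mk fx κ Φ t p D)) (hL κ Φ t p D (gT mk gx κ Φ t p D) (fT mk fx κ Φ t p D)) (vL κ Φ t p D (gT mk gx κ Φ t p D) (fT mk fx κ Φ t p D)) (sgOf du) (NrY κ Φ t p D (gT mk gx κ Φ t p D) (fT mk fx κ Φ t p D) P (yLFs κ Φ t p D c mk (gT mk gx κ Φ t p D) (fT mk fx κ Φ t p D) (sgOf du) σh) x du z))| ≤ 6 * u₀A κ Φ t p D (gT mk gx κ Φ t p D) (fT mk fx κ Φ t p D) := by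
    obtain ⟨a1, a2⟩ := abs_le.1 he5; obtain ⟨b1, b2⟩ := abs_le.1 hF; exact abs_le.2 ⟨by linarith, by linarith⟩
  have hbw2 := (bwY_eq κ Φ t p D (gT mk gx κ Φ t p D) (fT mk fx κ Φ t p D)).2
  have hFst : FcA κ Φ t p D (gT mk gx κ Φ t p D) (fT mk fx κ Φ t p D) ((yLFs κ Φ t p D c mk (gT mk gx κ Φ t p D) (fT mk fx κ Φ t p D) (sgOf du) σh) + Skelφ.crossOffY (nL κ Φ t p D (gT mk gx κ Φ t p D) (fT mk fx κ Φ t p D)) (ℓL κ Φ t p D (gT mk gx κ Φ t p D) (fT mk fx κ Φ t p D)) (hL κ Φ t p D (gT mk gx κ Φ t p D) (fT mk fx κ Φ t p D)) (vL κ Φ t p D (gT mk gx κ Φ t p D) (fT mk fx κ Φ t p D)) (sgOf du) (NrY κ Φ t p D (gT mk gx κ Φ t p D) (fT mk fx κ Φ t p D) P (yLFs κ Φ t p D c mk (gT mk gx κ Φ t p D) (fT mk fx κ Φ t p D) (sgOf du) σh) x du z)) + u₀A κ Φ t p D (gT mk gx κ Φ t p D) (fT mk fx κ Φ t p D) ≤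 T0Y P x du z + (bwY κ Φ t p D (gT mk gx κ Φ t p D) (fT mk fx κ Φ t p D)) := by obtain ⟨-, a2⟩ := abs_le.1 he6; linarith
  exact ⟨hNr600, N3WY_range κ Φ t p D (gT mk gx κ Φ t p D) (fT mk fx κ Φ t p D) P hP ((yLFs κ Φ t p D c mk (gT mk gx κ Φ t p D) (fT mk fx κ Φ t p D) (sgOf du) σh) + Skelφ.crossOffY (nL κ Φ t p D (gT mk gx κ Φ t p D) (fT mk fx κ Φ t p D)) (ℓL κ Φ t p D (gT mk gx κ Φ t p D) (fT mk fx κ Φ t p D)) (hL κ Φ t p D (gT mk gx κ Φ t p D) (fT mk fx κ Φ t p D)) (vL κ Φ t p D (gT mk gx κ Φ t p D) (fT mk fx κ Φ t p D)) (sgOf du) (NrY κ Φ t p D (gT mk gx κ Φ t p D) (fT mk fx κ Φ t p D) P (yLFs κ Φ t p D c mk (gT mk gx κ Φ t p D) (fT mk fx κ Φ t p D) (sgOf du) σh) x du z)) x du hd z hz hkE he6 (by linarith) hbw2 hFst⟩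

end KS

end NegB

end PlanarSkeletonFrmQuasi

end Summit.CriticalPhenomena.PercolationContinuityZ3.Theorems.Transplant

end
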